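import Summits.AtomisticToContinuum.HydrodynamicLimit.Theorems.OneFlightGossipEngineCollisionActivityTailsPlaqueSplit
import Literature.MathematicalPhysics.KineticTheory.HardSphereCampbellWindows
import HarnessLib

/-!
# `CollisionActivityTails` (stmt-AtomisticToContinuum-13734), line `plaque-thinning-count-ld`:
# stub `stub_uncActShift` — the start-shift identity of the untagged cold activity on the good set

Helper file (`--supports stmt-AtomisticToContinuum-13734`) for the crux
`Summit.AtomisticToContinuum.HydrodynamicLimit.Theses.OneFlightGossipEngine.CollisionActivityTails`, skeleton line
`plaque-thinning-count-ld` (`Cruxes/CollisionActivityTails/Lines/plaque_thinning_count_ld.lean`), registered stub 2s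
`stub_uncActShift : UncActShift`, over the landed vocabulary of `…Theorems.CollisionActivityTailsPlaqueSplit` (`uncAct`, `imp`,
`relSpeed`, `Tagged`; this file lives in that namespace, the skeleton bridges its own copy of `UncActShift` definitionally).

Statement: for a good initial datum `z` of the hard-sphere flow `Φ`, the untagged cold activity of sphere `i` over the
window `(s, s + w]` of the orbit of `z` equals the untagged cold activity over `(0, w]` of the orbit of `Φ_s z`
(`w = window τ N = τ ℓ_N`). Pure pathwise bookkeeping, no measure: with the invariance of the global Gibbs law under `Φ_s`
(`measurePreserving_flow_localGibbsLaw_const`) it is the `s`-uniformity of every equilibrium statement of the line.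

Proof. The summand of `uncAct` reads the time argument only through the `time` field of the collision record
`HardSphereCollisionRecord.ofConfig`, which the impulse `imp = ‖v_k⁺ - v_k⁻‖` does not use, so
`imp σ N cfg t k l = imp σ N cfg 0 k l` definitionally; `simp only` with the `simps` projections `ofConfig_postVel`,
`ofConfig_preVel` makes the summand syntactically time-free on both sides. With a time-independent mark the identity is
the landed shift lemma `campbell_collisionPairSum_flow_shift_Ioc`
(`Literature/MathematicalPhysics/KineticTheory/HardSphereCampbellWindows.lean`): on the good set `Φ_u (Φ_s z) = Φ_{u+s} z`,
so the collision times of the shifted orbit are the translated collision times and the `finsum` over `(0, w]` reindexes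
to `(0 + s, w + s] = (s, s + w]`.

References: I. Gallagher, L. Saint-Raymond, B. Texier, *From Newton to Boltzmann* (2013), §4.1, Prop. 4.1.1 (the
hard-sphere flow is a one-parameter group on the good set); C. Cercignani, R. Illner, M. Pulvirenti, *The Mathematical
Theory of Dilute Gases* (1994), §4.2, App. 4.A (collision sums along the flow). Elementary bookkeeping; recorded here.
-/

noncomputable section

open MeasureTheory Set Filter Topology
open scoped ENNReal

namespace Summit.AtomisticToContinuum.HydrodynamicLimit.Theorems.CollisionActivityTailsPlaqueSplit

open Literature.MathematicalPhysics.KineticTheory Literature.Analysis.FluidPDE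
open Summit.AtomisticToContinuum.HydrodynamicLimit.Theorems.CollisionActivityTailsActivityDomination
  (Flow Cfg window act tdist nearCount)

/-! ## The statement (VERBATIM copy of the skeleton's `UncActShift`) -/

/-- **STUB 2s — START SHIFT** (assembly piece: `HardSphereFlow.flow_add` on the good set, reindexing of the collision
`finsum` along `u ↦ u + s`, and the fact that the summand of `uncAct` reads the configuration only). The untagged activity
over the window `(s, s + w]` of the orbit of a good datum `z` is the untagged activity over `(0, w]` of the orbit of
`Φ_s z`. With the invariance of the global Gibbs law under `Φ_s` (`measurePreserving_flow_localGibbsLaw_const`) this is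
the `s`-uniformity of every equilibrium statement of the line. -/
def UncActShift : Prop :=
  ∀ (σ : ℝ) (N : ℕ) (Φ : Flow σ N) (Θ y : ℝ) (K : ℕ) (τ s : ℝ) (i : Fin (N + 1)) (z : Cfg N),
    z ∈ Φ.good → uncAct Θ y K Φ τ s i z = uncAct Θ y K Φ τ 0 i (Φ.flow s z)

/-! ## The proof -/

/-- **STUB 2s, proved**: the start-shift identity of the untagged cold activity on the good set. -/
theorem stub_uncActShift : UncActShift := by
  intro σ N Φ Θ y K τ s i z hz
  -- the summand of `uncAct` reads the time only through the `time` field of the record: rewrite the impulse to its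
  -- time-free form `‖v_k - (reflectVel (x_k - x_l) (v_k, v_l)).1‖` on both sides
  unfold uncAct imp
  simp only [HardSphereCollisionRecord.ofConfig_postVel, HardSphereCollisionRecord.ofConfig_preVel]
  -- time-independent marks shift along the flow (`Φ_u (Φ_s z) = Φ_{u+s} z` on the good set)
  rw [campbell_collisionPairSum_flow_shift_Ioc Φ hz s 0 (0 + window τ N), zero_add, zero_add,
    add_comm (window τ N) s]

end Summit.AtomisticToContinuum.HydrodynamicLimit.Theorems.CollisionActivityTailsPlaqueSplit

end
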